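import Summits.QuantumFields.BalabanUV.T4Continuum.Spine.NE1p.DressedTransportAssembledModSliceWin
import Summits.QuantumFields.BalabanUV.T4Continuum.Spine.NE1p.DressedTransportUniformWin

/-!
# T⁴ programme, spine estimate NE1′ (node O3b/H2) — ROW S3 ∘ ROW S1e: THE PER-CUTOFF BUNDLE OVER THE ASSEMBLED LEAF WITH
# CUTOFF-FREE WINDOWS (END-F′-mod-swin under `WindowScheduleModWin`) and (w4) discharged by a K-free ratio
# (swarm item S3h «assembled slice-win face», part 1, of `t4/formal/NE1p/LEAVES.md` v2.3.x; INTENT CLAIMS.log l.9922)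

Cell `pub-balaban`, sub-cell `t4`, BINDER-OWNERS row NE1′, formalisation crew `b2b-balaban-t4-ne1p-formalise-*`, seat `…-leaf-09`
(gen 2; rows S3∕S3b∕S3-sup∕S3d∕S3g).  ADDITIVE — imports leaf-04's `Spine/NE1p/DressedTransportAssembledModSliceWin` (row S1e part 5:
END-F′-mod-swin `transportLeaf_assembled_mod_swin` and **`transportLeaf_assembled_mod_swin_of_schedule`** — the ASSEMBLED transport
leaf with its sixteen geometric ∕ radius ∕ window binders discharged from ONE `W : WindowScheduleModWin r w`, p214439) and this seat's
`Spine/NE1p/DressedTransportUniformWin` (S3g part 1: `hdom_of_seqRatio`, `hα_const`, `κ_nonneg_win`; through it row S3's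
`uniformConstantsCell` ∕ `bookingLeavesCell` ∕ `dressedStability_of_cell`) ONLY; modifies nothing.

WHAT THIS FILE DOES (the assembled sibling of S3g = S3 ∘ S1d; the typer's anticipated «END-ALL-slice-win», R-T35 (i), part 1).
Leaf-04's `transportLeaf_assembled_mod_swin_of_schedule` displays, besides the estimate ∕ dictionary binders, the step-factor profile
`α` (`hα`) and (w4) `hdom` along the schedule's diameters `2σ k` and chart radii `ϱc k`.  Here:
* §1 **`transportLeaf_assembled_swin_uniform_of_schedule`** — that END with `hα`∕`hdom` DISCHARGED from a DISPLAYED K-free ratio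
  `hratio : ∀ k, 2σ k ≤ κ·ϱc k` at the CONSTANT profile `α := fun _ => alphaCell κ` (S3g's `hdom_of_seqRatio` ∕ `hα_const` ∕
  `κ_nonneg_win` through the parent projection `W.toWindowScheduleWin`); conclusion VERBATIM the field type of `BookingLeaves.htr` at
  `C = 4c_δ∕r`, `ρ i = ψ·alphaCell κ`.  Displayed (estimate ∕ dictionary ∕ context ONLY — no window geometry, no radius floor, no
  uniform-`w` window budget, NO `hP`): (w1) `hsl` on `bondBall d (W.ρw k′)` with SLICE window `W.wc k′`; H2 `hFn`∕`h𝒢`∕`hmeas` and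
  the Assembly dictionary `hQ`∕`hSg`∕`hs1`∕`hAsz_birth`∕`hAsz_step` (modulus form); (w2-act) `hB`∕`hE` (slice window `W.wc (k+1)`,
  chart radius `W.ϱc k`; printed TYPE [Balaban1989LargeFieldII] (1.65) p. 375, (1.71)–(1.75) pp. 379–380 — asserted for Bałaban's
  densities NOWHERE); the cutoff-free source-vs-budget tie `hcm : ‖c b k‖ ≤ m`; (I4′) `hδf` (fresh defects `≤ c_δψ^{k−k″}`), `hδfwk`
  (`≤ W.wc k`), `hpairx` (directions `≤ W.wc (k+1)`), `hdefwk`, `hrate`; `hDμ`, `hz₁`; attainment `hlin`; invariance `hinv`; scalars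
  `hr`∕`hcδ`∕`hψ`; `hratio`.
* §2 **`bookingLeaves_assembled_swin_of_schedule : BookingLeaves (uniformConstantsCell L (4c_δ∕r) c̄ κ N₀ A₀ m s̄⁰ ρ′ …) B T`** at the
  cell's transverse rate `ψ := L⁻²` (F-6's READING, k3 — a parameter choice): END-B's per-cutoff input with `htr` := §1 and (w7)
  `hρ`∕`hc`∕`hrate` by row S3; displayed in addition (w5) `hreg` + `0 ≤ creg k ≤ c̄`, (w2-act) `hs₀`, (w3-book) `hS`∕`hcount` at rate
  `L⁴`, (w1)+(w5b) `hbirth`, the located scalars `1 ≤ L`, `locCell L (4c_δ∕r) c̄ κ ≤ ρ′ < 1`, (w6) `hsmall`.  END-B over `∀ p K` of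
  these is S3g's `dressedStability_win_of_cell` verbatim (same bundle type); the all-cutoff face with the families spelled out is
  part 2 `DressedStabilityOfSliceWinSchedules`.
* §3 the instance on leaf-04's CUTOFF-FREE witness `WindowScheduleModWin.geometric r w q σ₀ ϱ₀ ρ∞` — its (w4) ratio is the CONSTANT
  `2σ₀∕(ϱ₀q)` (`geometric_ratio`), so it INHABITS `hratio` with the K-free `κ := 2σ₀∕(ϱ₀q)` (`geometric_mod_ratio_κ`; X40 INFO-1):
  ONE schedule, ONE `uniformConstantsCell … (2σ₀∕(ϱ₀q)) …` for every cutoff, birth window `ρ∞ + ((1+2q)σ₀+ϱ₀)∕(1−q)`.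

WHAT THIS CLOSES AT THE TYPED LEVEL AND WHAT IT DOES NOT (k1; located findings LF-1 = F-ne1pleaf08-1, LF-2 = F-ne1pleaf04-1).
With leaf-04's S1e the assembled leaf's window bookkeeping forces NO cutoff-dependent constant: no radius floor (LF-1 (3)), no
uniform-`w` chart window (LF-1 (4)), no uniform slice window in `hN2cx`∕`hpairx`∕`hP` (LF-2) — the schedule's per-step consumption
`wc (k+1) + ϱ₁ k + σ k` is summable and `geometric` realises a FINITE birth window.  Composed with row S3's K-∕μ-free constants, the
bundle of §2 has NO typed K-dependence left ANYWHERE EXCEPT in the displayed estimate binders themselves: (w1) `hsl` (analytic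
births of the D-terms on the scheduled windows), (w2-act) `hB`∕`hE` with THE NUMBER `s̄⁰ < 1` via (w6), (w4)'s constant `alphaCell κ`
inside (w7)'s located largeness, (I4′) `hδf`∕`hδfwk`∕`hpairx`∕`hrate` + `hcm` (F-6's rate ψ = L⁻² — load-bearing, k3; absolute-step
guards along a step-indexed schedule, X(S1d)∕X40 INFO-2), (w5) `hreg`, (w3-book) `hcount`, (w1)+(w5b) `hbirth`.  Whether Bałaban's
densities inhabit them with K-free scalars IS the wall — displayed, not decided; 0 of them is instantiated here.  The uniform `w`
survives only as the response-modulus RANGE and the bound `wc ≤ w` (X42 INFO-1) — no window cost.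

HONEST FRAMING.  Kernel composition over hypothesis shapes ([folklore]; 0 sorry; 0 citations used as facts; no `def … : Prop`).
Headline (c4): «BookingLeaves ∕ NE1′-per-cutoff ⇐ the DISPLAYED estimate binders + located largeness + a ratio-bounded
`WindowScheduleModWin` (cutoff-free windows available for the ASSEMBLED leaf)», NEVER «NE1′ proved»; 0 leaves instantiated on Bałaban's
densities; spine PROVED 0∕9.  Rung (B)+1 on ONE finite four-torus — NOT infinite volume, NOT a mass gap, NOT OS on ℝ⁴, NOT Clay.
HONEST DEPENDENCY: continuum YM on T⁴ ⇐ BetaPertH ∧ nine spine estimates (0/9 proved); BetaPertH ⇐ (D1) ∧ (D4) ∧ CAP+tail; G-an2-4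
gates asym, D1 and NE2/3/4.
-/

noncomputable section

namespace Summit.QuantumFields.BalabanUV.T4Continuum.NE1p.DressedTransportAssembledUniformSliceWin

open MeasureTheory Set Metric Finset
open scoped BigOperators
open Literature.MathematicalPhysics.QuantumFieldTheory.Balaban1983to89
open Literature.MathematicalPhysics.QuantumFieldTheory.Balaban1983to89.T4TermFormat
open Literature.MathematicalPhysics.QuantumFieldTheory.Balaban1983to89.T4GatedBooking
open Literature.MathematicalPhysics.QuantumFieldTheory.Balaban1983to89.T4TrajectoryComparison
open Literature.MathematicalPhysics.QuantumFieldTheory.Balaban1983to89.T4TrajectoryModulus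
open T4BirthChartTransport (GaugeInvariant BirthSlice RelGauge)
open T4BlockTransport (Fld NDir latMove latN)
open T4TrajectoryDensity
open Summit.QuantumFields.BalabanUV.T4Continuum.T4TrajectoryDensityDressed
open Summit.QuantumFields.BalabanUV.T4Continuum.NE1p.DressedRoot
open Summit.QuantumFields.BalabanUV.T4Continuum.NE1p.DressedWindowScheduleWin
open Summit.QuantumFields.BalabanUV.T4Continuum.NE1p.DressedWindowScheduleModWin
open Summit.QuantumFields.BalabanUV.T4Continuum.NE1p.DressedUniformConstants
open Summit.QuantumFields.BalabanUV.T4Continuum.NE1p.DressedTransportUniformWin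
open Summit.QuantumFields.BalabanUV.T4Continuum.NE1p.DressedTransportAssembledModSliceWin

/-! ## §1 END-F′-mod-swin under the schedule with (w4) discharged -/

section FunctionLevel

variable {r w : ℝ} (W : WindowScheduleModWin r w)
variable {B : T4TermFormat.Booking} {T : Trajectory B}
variable {R : Type*} [NormedRing R] [NormedAlgebra ℂ R] [MeasurableSpace R] {d : ℕ}

/-- **THE ASSEMBLED TRANSPORT LEAF UNDER A RATIO-BOUNDED `WindowScheduleModWin` — NO WINDOW GEOMETRY, NO FLOOR, NO `hP`, NO (w4)
BINDER** [bookkeeping]: leaf-04's `transportLeaf_assembled_mod_swin_of_schedule` with the step-factor profile FIXED to the K-free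
constant `α := fun _ => alphaCell κ` for a displayed ratio bound `hratio : ∀ k, 2σ k ≤ κ·ϱc k` (S3g `hdom_of_seqRatio` ∕ `hα_const`
through `W.toWindowScheduleWin`).  Displayed = estimate ∕ dictionary ∕ context binders only (module docstring §1).  Conclusion:
VERBATIM the field type of `BookingLeaves.htr` with `C = 4c_δ∕r`, `ρ i = ψ·alphaCell κ`. [folklore] -/
theorem transportLeaf_assembled_swin_uniform_of_schedule {κ : ℝ} {Fn : B.Birth → ℕ → ℕ → Fld d R → ℂ}
    {rel : B.Birth → ℕ → ℕ → Fld d R → Fld d R → Prop}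
    {ref : B.Birth → ℕ → Fld d R → Fld d R} {base : B.Birth → ℕ → Fld d R → ℝ}
    {𝒜 𝒬 : B.Birth → ℕ → Fld d R → Fld d R → ℂ} {q : B.Birth → ℕ → Fld d R → ℂ}
    {μ : B.Birth → ℕ → Measure (Fld d R)} {z₀ z₁ : B.Birth → ℕ → Fld d R}
    {defect : B.Birth → ℕ → ℕ → ℝ} {cδ ψ m : ℝ} {s s1 : B.Birth → ℕ → ℝ}
    {Asz : B.Birth → ℕ → ℕ → ℝ} {S : ℕ → B.Birth → Finset B.Birth}
    {Sg : ℕ → B.Birth → Finset (B.Birth × ℕ)} {c : B.Birth → ℕ → ℂ} {δf : B.Birth → ℕ → B.Birth × ℕ → ℝ}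
    (hratio : ∀ k, 2 * W.σ k ≤ κ * W.ϱc k)
    (hr : 0 < r) (hcδ : 0 ≤ cδ) (hψ : 0 ≤ ψ)
    (hsl : ∀ (b : B.Birth) (k' : ℕ), B.birthScale b ≤ k' → k' ≤ B.K →
      RanBelow (budgetGate T s m S (4 * cδ / r) (fun i => ψ * (fun _ : ℕ => alphaCell κ) i)) k' →
      BirthSlice (Fn b k' k') latMove latN (bondBall d (W.ρw k') : Set (Fld d R)) (W.wc k') r (T.gen b k'))
    (hFn : ∀ (b : B.Birth) (k' k : ℕ), B.birthScale b ≤ k' → k' ≤ k → k + 1 ≤ B.K →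
      RanBelow (budgetGate T s m S (4 * cδ / r) (fun i => ψ * (fun _ : ℕ => alphaCell κ) i)) (k + 1) →
      ∀ U, Fn b k' (k + 1) U =
        wOp (expWeight (base b k) (𝒜 b k + 𝒬 b k)) (μ b k) (z₀ b k) U (fun z => Fn b k' k (U + z)))
    (h𝒢 : ∀ (b : B.Birth) (k' k : ℕ), B.birthScale b ≤ k' → k' ≤ k → k + 1 ≤ B.K →
      RanBelow (budgetGate T s m S (4 * cδ / r) (fun i => ψ * (fun _ : ℕ => alphaCell κ) i)) (k + 1) →
      ∀ U, (fun z => Fn b k' k (U + z)) ∈ BddClass ℂ (μ b k))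
    (hB : ∀ (b : B.Birth) (k' k : ℕ), B.birthScale b ≤ k' → k' ≤ k → k + 1 ≤ B.K →
      RanBelow (budgetGate T s m S (4 * cδ / r) (fun i => ψ * (fun _ : ℕ => alphaCell κ) i)) (k + 1) →
      RealBaseAt (ref b k) (base b k) (𝒜 b k) (μ b k) (bondBall d (W.ρw (k + 1)) : Set (Fld d R)))
    (hE : ∀ (b : B.Birth) (k' k : ℕ), B.birthScale b ≤ k' → k' ≤ k → k + 1 ≤ B.K →
      RanBelow (budgetGate T s m S (4 * cδ / r) (fun i => ψ * (fun _ : ℕ => alphaCell κ) i)) (k + 1) →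
      ExponentSliceAt (ref b k) (𝒜 b k) (μ b k) latMove latN (bondBall d (W.ρw (k + 1)) : Set (Fld d R)) (W.wc (k + 1))
        (W.ϱc k) (s b k))
    (hQ : ∀ b k, (fun U z => 𝒬 b k U z - q b k U) =
      fun U z => c b k * ∑ p ∈ Sg k b, (Fn p.1 p.2 k (U + z) - Fn p.1 p.2 k (U + z₁ b k)))
    (hSg : ∀ k b, ∀ p ∈ Sg k b, p.1 ∈ S k b ∧ B.birthScale p.1 ≤ p.2 ∧ p.2 ≤ k)
    (hs1 : ∀ b k, s1 b k = ‖c b k‖ * ∑ p ∈ Sg k b,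
      (4 / r * stepProd (fun _ : ℕ => alphaCell κ) p.2 k * T.gen p.1 p.2) * δf b k p)
    (hAsz_birth : ∀ f k'', Asz f k'' k'' = T.gen f k'')
    (hAsz_step : ∀ f k'' k, B.birthScale f ≤ k'' → k'' ≤ k →
      Asz f k'' (k + 1) = Real.exp (3 * (s f k + s1 f k)) * Asz f k'' k)
    (hcm : ∀ b k, ‖c b k‖ ≤ m)
    (hδf : ∀ b k, ∀ p ∈ Sg k b, 0 ≤ δf b k p ∧ δf b k p ≤ cδ * ψ ^ (k - p.2))
    (hδfwk : ∀ b k, ∀ p ∈ Sg k b, δf b k p ≤ W.wc k)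
    (hDμ : ∀ b k, ∀ᵐ z ∂μ b k, z ∈ (bondBall d (W.σ k) : Set (Fld d R)))
    (hz₁ : ∀ b k, z₁ b k ∈ (bondBall d (W.σ k) : Set (Fld d R)))
    (hpairx : ∀ (b : B.Birth) (k' k : ℕ), B.birthScale b ≤ k' → k' ≤ k →
      ∀ p ∈ Sg k b, ∀ U₀ ∈ (bondBall d (W.ρw (k + 1)) : Set (Fld d R)), ∀ pd : NDir d R, 0 < latN pd →
        latN pd ≤ W.wc (k + 1) →
        ∀ᵐ z ∂μ b k, ∀ t ∈ tube (W.ϱ₁ k / latN pd),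
          RelGauge (rel p.1 p.2 k) latMove latN (latMove U₀ pd t + z₁ b k) (latMove U₀ pd t + z) (δf b k p))
    (hinv : ∀ b k' k, GaugeInvariant (rel b k' k) (Fn b k' k))
    (hmeas : ∀ (b f : B.Birth) (k'' k : ℕ) (U : Fld d R), AEStronglyMeasurable (fun z => Fn f k'' k (U + z)) (μ b k))
    (hdefwk : ∀ (b : B.Birth) (k' k : ℕ), defect b k' k ≤ W.wc k)
    (hrate : ∀ (b : B.Birth) (k' k : ℕ), B.birthScale b ≤ k' → k' ≤ k → k ≤ B.K →
      defect b k' k ≤ cδ * ψ ^ (k - k'))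
    (hlin : ∀ (b : B.Birth) (k' k : ℕ), B.birthScale b ≤ k' → k' ≤ k → k ≤ B.K →
      RanBelow (budgetGate T s m S (4 * cδ / r) (fun i => ψ * (fun _ : ℕ => alphaCell κ) i)) k → ∀ ε > 0,
      ∃ U₀ ∈ (bondBall d (W.ρw k) : Set (Fld d R)), ∃ U₁ : Fld d R,
        RelGauge (rel b k' k) latMove latN U₀ U₁ (defect b k' k) ∧
        T.lin b k' k ≤ ‖Fn b k' k U₁ - Fn b k' k U₀‖ + ε) :
    T.TransportsFromVar (4 * cδ / r) (fun i => ψ * (fun _ : ℕ => alphaCell κ) i)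
      (budgetGate T s m S (4 * cδ / r) (fun i => ψ * (fun _ : ℕ => alphaCell κ) i)) :=
  transportLeaf_assembled_mod_swin_of_schedule W
    (hα := hα_const (κ_nonneg_win W.toWindowScheduleWin hratio)) (hr := hr) (hcδ := hcδ) (hψ := hψ)
    (hsl := hsl) (hFn := hFn) (h𝒢 := h𝒢) (hB := hB) (hE := hE) (hQ := hQ) (hSg := hSg) (hs1 := hs1)
    (hAsz_birth := hAsz_birth) (hAsz_step := hAsz_step) (hcm := hcm) (hδf := hδf) (hδfwk := hδfwk) (hDμ := hDμ)
    (hz₁ := hz₁) (hpairx := hpairx)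
    (hdom := hdom_of_seqRatio (B := B) W.hϱc hratio)
    (hinv := hinv) (hmeas := hmeas) (hdefwk := hdefwk) (hrate := hrate) (hlin := hlin)

end FunctionLevel

/-! ## §2 The per-cutoff face: `BookingLeaves` over the uniform constants (assembled, cutoff-free windows) -/

section Bundle

variable {r w : ℝ} (W : WindowScheduleModWin r w)
variable {B : T4TermFormat.Booking} {T : Trajectory B}
variable {R : Type*} [NormedRing R] [NormedAlgebra ℂ R] [MeasurableSpace R] {d : ℕ}

/-- **THE PER-CUTOFF BUNDLE OVER THE ASSEMBLED SLICE-WINDOW FACE** [bookkeeping]: at the cell's transverse rate `ψ := L⁻²` (F-6's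
reading — a parameter choice, k3) and the K-∕μ-free constants `U := uniformConstantsCell L (4c_δ∕r) c̄ κ N₀ A₀ m s̄⁰ ρ′` of row S3,
the leaf binders `BookingLeaves U B T` of END-B with T `htr` DISCHARGED by §1 (assembled: no `hP`; scheduled: no window geometry, no
floor; ratio: no (w4)) and (w7) `hrate`∕`hρ`∕`hc` DISCHARGED by row S3 (`bookingLeavesCell`).  DISPLAYED, per cutoff: §1's estimate ∕
dictionary binders; (w5) `hreg` with `0 ≤ creg k ≤ c̄`; (w2-act) `hs₀ : s b k ≤ s̄⁰`; (w3-book) `hS`∕`hcount` at rate `L⁴` (row S4's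
instance); (w1)+(w5b) `hbirth` in the class `twoRate A₀ (rhoOne L⁻² (4c_δ∕r) c̄ κ) L⁻³ K` (row S5's suppliers); the located scalars
`1 ≤ L`, `locCell L (4c_δ∕r) c̄ κ ≤ ρ′ < 1` ((w7)), `m·(N₀A₀(1−ρ′)⁻¹) ≤ 1 − s̄⁰` ((w6)).  END-B over `∀ p K` of these bundles is S3g's
`DressedTransportUniformWin.dressedStability_win_of_cell` VERBATIM (same bundle type); part 2 spells the families out.  Nothing of
Bałaban's densities asserted. [folklore] -/
def bookingLeaves_assembled_swin_of_schedule {κ L cbar N₀ A₀ sbar ρ' : ℝ} {Fn : B.Birth → ℕ → ℕ → Fld d R → ℂ}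
    {rel : B.Birth → ℕ → ℕ → Fld d R → Fld d R → Prop}
    {ref : B.Birth → ℕ → Fld d R → Fld d R} {base : B.Birth → ℕ → Fld d R → ℝ}
    {𝒜 𝒬 : B.Birth → ℕ → Fld d R → Fld d R → ℂ} {q : B.Birth → ℕ → Fld d R → ℂ}
    {μ : B.Birth → ℕ → Measure (Fld d R)} {z₀ z₁ : B.Birth → ℕ → Fld d R}
    {defect : B.Birth → ℕ → ℕ → ℝ} {cδ m : ℝ} {s s1 : B.Birth → ℕ → ℝ}
    {Asz : B.Birth → ℕ → ℕ → ℝ} {S : ℕ → B.Birth → Finset B.Birth}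
    {Sg : ℕ → B.Birth → Finset (B.Birth × ℕ)} {c : B.Birth → ℕ → ℂ} {δf : B.Birth → ℕ → B.Birth × ℕ → ℝ}
    {creg : ℕ → ℝ}
    -- the schedule's K-free diameter∕radius ratio
    (hratio : ∀ k, 2 * W.σ k ≤ κ * W.ϱc k)
    -- row S3's located scalars ((w7) largeness, (w6) window) and signs
    (hL : 1 ≤ L) (hcbar : 0 ≤ cbar) (hN₀ : 0 ≤ N₀) (hA₀ : 0 ≤ A₀) (hm : 0 ≤ m)
    (hloc : locCell L (4 * cδ / r) cbar κ ≤ ρ') (hρ'1 : ρ' < 1)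
    (hsmall : m * (N₀ * A₀ * (1 - ρ')⁻¹) ≤ 1 - sbar)
    -- scalars of the END
    (hr : 0 < r) (hcδ : 0 ≤ cδ)
    -- §1's estimate ∕ dictionary binders at ψ := L⁻², α := alphaCell κ
    (hsl : ∀ (b : B.Birth) (k' : ℕ), B.birthScale b ≤ k' → k' ≤ B.K →
      RanBelow (budgetGate T s m S (4 * cδ / r) (fun i => (L ^ 2)⁻¹ * (fun _ : ℕ => alphaCell κ) i)) k' →
      BirthSlice (Fn b k' k') latMove latN (bondBall d (W.ρw k') : Set (Fld d R)) (W.wc k') r (T.gen b k'))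
    (hFn : ∀ (b : B.Birth) (k' k : ℕ), B.birthScale b ≤ k' → k' ≤ k → k + 1 ≤ B.K →
      RanBelow (budgetGate T s m S (4 * cδ / r) (fun i => (L ^ 2)⁻¹ * (fun _ : ℕ => alphaCell κ) i)) (k + 1) →
      ∀ U, Fn b k' (k + 1) U =
        wOp (expWeight (base b k) (𝒜 b k + 𝒬 b k)) (μ b k) (z₀ b k) U (fun z => Fn b k' k (U + z)))
    (h𝒢 : ∀ (b : B.Birth) (k' k : ℕ), B.birthScale b ≤ k' → k' ≤ k → k + 1 ≤ B.K →
      RanBelow (budgetGate T s m S (4 * cδ / r) (fun i => (L ^ 2)⁻¹ * (fun _ : ℕ => alphaCell κ) i)) (k + 1) →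
      ∀ U, (fun z => Fn b k' k (U + z)) ∈ BddClass ℂ (μ b k))
    (hB : ∀ (b : B.Birth) (k' k : ℕ), B.birthScale b ≤ k' → k' ≤ k → k + 1 ≤ B.K →
      RanBelow (budgetGate T s m S (4 * cδ / r) (fun i => (L ^ 2)⁻¹ * (fun _ : ℕ => alphaCell κ) i)) (k + 1) →
      RealBaseAt (ref b k) (base b k) (𝒜 b k) (μ b k) (bondBall d (W.ρw (k + 1)) : Set (Fld d R)))
    (hE : ∀ (b : B.Birth) (k' k : ℕ), B.birthScale b ≤ k' → k' ≤ k → k + 1 ≤ B.K →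
      RanBelow (budgetGate T s m S (4 * cδ / r) (fun i => (L ^ 2)⁻¹ * (fun _ : ℕ => alphaCell κ) i)) (k + 1) →
      ExponentSliceAt (ref b k) (𝒜 b k) (μ b k) latMove latN (bondBall d (W.ρw (k + 1)) : Set (Fld d R)) (W.wc (k + 1))
        (W.ϱc k) (s b k))
    (hQ : ∀ b k, (fun U z => 𝒬 b k U z - q b k U) =
      fun U z => c b k * ∑ p ∈ Sg k b, (Fn p.1 p.2 k (U + z) - Fn p.1 p.2 k (U + z₁ b k)))
    (hSg : ∀ k b, ∀ p ∈ Sg k b, p.1 ∈ S k b ∧ B.birthScale p.1 ≤ p.2 ∧ p.2 ≤ k)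
    (hs1 : ∀ b k, s1 b k = ‖c b k‖ * ∑ p ∈ Sg k b,
      (4 / r * stepProd (fun _ : ℕ => alphaCell κ) p.2 k * T.gen p.1 p.2) * δf b k p)
    (hAsz_birth : ∀ f k'', Asz f k'' k'' = T.gen f k'')
    (hAsz_step : ∀ f k'' k, B.birthScale f ≤ k'' → k'' ≤ k →
      Asz f k'' (k + 1) = Real.exp (3 * (s f k + s1 f k)) * Asz f k'' k)
    (hcm : ∀ b k, ‖c b k‖ ≤ m)
    (hδf : ∀ b k, ∀ p ∈ Sg k b, 0 ≤ δf b k p ∧ δf b k p ≤ cδ * ((L ^ 2)⁻¹) ^ (k - p.2))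
    (hδfwk : ∀ b k, ∀ p ∈ Sg k b, δf b k p ≤ W.wc k)
    (hDμ : ∀ b k, ∀ᵐ z ∂μ b k, z ∈ (bondBall d (W.σ k) : Set (Fld d R)))
    (hz₁ : ∀ b k, z₁ b k ∈ (bondBall d (W.σ k) : Set (Fld d R)))
    (hpairx : ∀ (b : B.Birth) (k' k : ℕ), B.birthScale b ≤ k' → k' ≤ k →
      ∀ p ∈ Sg k b, ∀ U₀ ∈ (bondBall d (W.ρw (k + 1)) : Set (Fld d R)), ∀ pd : NDir d R, 0 < latN pd →
        latN pd ≤ W.wc (k + 1) →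
        ∀ᵐ z ∂μ b k, ∀ t ∈ tube (W.ϱ₁ k / latN pd),
          RelGauge (rel p.1 p.2 k) latMove latN (latMove U₀ pd t + z₁ b k) (latMove U₀ pd t + z) (δf b k p))
    (hinv : ∀ b k' k, GaugeInvariant (rel b k' k) (Fn b k' k))
    (hmeas : ∀ (b f : B.Birth) (k'' k : ℕ) (U : Fld d R), AEStronglyMeasurable (fun z => Fn f k'' k (U + z)) (μ b k))
    (hdefwk : ∀ (b : B.Birth) (k' k : ℕ), defect b k' k ≤ W.wc k)
    (hrate : ∀ (b : B.Birth) (k' k : ℕ), B.birthScale b ≤ k' → k' ≤ k → k ≤ B.K →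
      defect b k' k ≤ cδ * ((L ^ 2)⁻¹) ^ (k - k'))
    (hlin : ∀ (b : B.Birth) (k' k : ℕ), B.birthScale b ≤ k' → k' ≤ k → k ≤ B.K →
      RanBelow (budgetGate T s m S (4 * cδ / r) (fun i => (L ^ 2)⁻¹ * (fun _ : ℕ => alphaCell κ) i)) k →
      ∀ ε > 0, ∃ U₀ ∈ (bondBall d (W.ρw k) : Set (Fld d R)), ∃ U₁ : Fld d R,
        RelGauge (rel b k' k) latMove latN U₀ U₁ (defect b k' k) ∧
        T.lin b k' k ≤ ‖Fn b k' k U₁ - Fn b k' k U₀‖ + ε)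
    -- the booking-level wall binders: (w5) regeneration, (w2-act) margin, (w3-book) counts, (w1)+(w5b) births
    (hc0 : ∀ k, 0 ≤ creg k) (hcb : ∀ k, k < B.K → creg k ≤ cbar)
    (hreg : T.RegeneratesFromVar creg
      (budgetGate T s m S (4 * cδ / r) (fun _ : ℕ => (L ^ 2)⁻¹ * alphaCell κ)))
    (hs₀ : ∀ b k, s b k ≤ sbar)
    (hS : ∀ k b, ∀ f ∈ S k b, B.birthScale f ≤ k)
    (hcount : ∀ k b, ∀ j ≤ k, (((S k b).filter fun f => B.birthScale f = j).card : ℝ) ≤ N₀ * (L ^ 4) ^ (k - j))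
    (hbirth : T.BirthsFromOld (4 * cδ / r) (fun _ : ℕ => (L ^ 2)⁻¹ * alphaCell κ)
      (twoRate A₀ (rhoOne (L ^ 2)⁻¹ (4 * cδ / r) cbar κ) (L⁻¹ ^ 3) B.K)
      (budgetGate T s m S (4 * cδ / r) (fun _ : ℕ => (L ^ 2)⁻¹ * alphaCell κ))) :
    BookingLeaves (uniformConstantsCell L (4 * cδ / r) cbar κ N₀ A₀ m sbar ρ' hL
      (div_nonneg (mul_nonneg (by norm_num) hcδ) hr.le) hcbar (κ_nonneg_win W.toWindowScheduleWin hratio) hN₀ hA₀ hm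
      hloc hρ'1 hsmall) B T :=
  bookingLeavesCell hL (div_nonneg (mul_nonneg (by norm_num) hcδ) hr.le) hcbar (κ_nonneg_win W.toWindowScheduleWin hratio) hN₀
    hA₀ hm hloc hρ'1 hsmall creg s S hc0 hcb hS hcount hs₀ hbirth
    (transportLeaf_assembled_swin_uniform_of_schedule W hratio hr hcδ (inv_nonneg.mpr (sq_nonneg L)) hsl hFn h𝒢 hB hE hQ
      hSg hs1 hAsz_birth hAsz_step hcm hδf hδfwk hDμ hz₁ hpairx hinv hmeas hdefwk hrate hlin)
    hreg

end Bundle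

/-! ## §3 The instance on leaf-04's cutoff-free witness (κ := 2σ₀∕(ϱ₀q)) -/

section Witness

variable {B : T4TermFormat.Booking}

/-- [decided toy] Leaf-04's cutoff-free witness for the assembled leaf, `WindowScheduleModWin.geometric r w q σ₀ ϱ₀ ρ∞`
(`ϱc k = ϱ₀q^{k+1}`, `σ k = σ₀q^k`), INHABITS §1's ratio binder with the K-free `κ := 2σ₀∕(ϱ₀q)` — its (w4) ratio is that
CONSTANT (`WindowScheduleModWin.geometric_ratio`; X40 INFO-1). [folklore] -/
theorem geometric_mod_ratio_κ {r w q σ₀ ϱ₀ ρinf : ℝ} (hq0 : 0 < q) (hq1 : q < 1) (hσ₀ : 0 < σ₀) (hσ₀w : 2 * σ₀ ≤ w)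
    (hϱ₀ : 0 < ϱ₀) (hϱ₀r : ϱ₀ ≤ r) :
    ∀ k, 2 * (WindowScheduleModWin.geometric r w q σ₀ ϱ₀ ρinf hq0 hq1 hσ₀ hσ₀w hϱ₀ hϱ₀r).σ k ≤
      (2 * σ₀ / (ϱ₀ * q)) * (WindowScheduleModWin.geometric r w q σ₀ ϱ₀ ρinf hq0 hq1 hσ₀ hσ₀w hϱ₀ hϱ₀r).ϱc k := by
  intro k
  show 2 * (σ₀ * q ^ k) ≤ 2 * σ₀ / (ϱ₀ * q) * (ϱ₀ * q ^ (k + 1))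
  have hq : q ≠ 0 := hq0.ne'
  have hϱ : ϱ₀ ≠ 0 := hϱ₀.ne'
  rw [pow_succ]
  field_simp
  ring_nf
  exact le_rfl

/-- [decided toy] Hence (w4) in the assembled END's indexing along the witness with the constant profile
`α := fun _ => alphaCell (2σ₀∕(ϱ₀q))` at EVERY step of EVERY cutoff (S3g `hdom_of_seqRatio` through the parent projection). [folklore] -/
theorem hdom_swin_geometric {r w q σ₀ ϱ₀ ρinf : ℝ} (hq0 : 0 < q) (hq1 : q < 1) (hσ₀ : 0 < σ₀) (hσ₀w : 2 * σ₀ ≤ w)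
    (hϱ₀ : 0 < ϱ₀) (hϱ₀r : ϱ₀ ≤ r) :
    ∀ k, k + 1 ≤ B.K →
      Real.exp 3 * (1 + 4 * (2 * (WindowScheduleModWin.geometric r w q σ₀ ϱ₀ ρinf hq0 hq1 hσ₀ hσ₀w hϱ₀ hϱ₀r).σ k) /
        (WindowScheduleModWin.geometric r w q σ₀ ϱ₀ ρinf hq0 hq1 hσ₀ hσ₀w hϱ₀ hϱ₀r).ϱc k) ≤
      (fun _ : ℕ => alphaCell (2 * σ₀ / (ϱ₀ * q))) k :=
  hdom_of_seqRatio (B := B) (WindowScheduleModWin.geometric r w q σ₀ ϱ₀ ρinf hq0 hq1 hσ₀ hσ₀w hϱ₀ hϱ₀r).hϱc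
    (geometric_mod_ratio_κ hq0 hq1 hσ₀ hσ₀w hϱ₀ hϱ₀r)

/-- [decided toy] The witness's data that enter the composition contain NO cutoff: birth window
`ρw 0 = ρ∞ + ((1+2q)σ₀+ϱ₀)∕(1−q)`, every window between `ρ∞` and it, ratio constant `2σ₀∕(ϱ₀q) ≥ 0` — so ONE schedule and ONE
`uniformConstantsCell … (2σ₀∕(ϱ₀q)) …` serve §2 at every `(p, K)`. [folklore] -/
theorem geometric_mod_birthWindow_ratio {r w q σ₀ ϱ₀ ρinf : ℝ} (hq0 : 0 < q) (hq1 : q < 1) (hσ₀ : 0 < σ₀)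
    (hσ₀w : 2 * σ₀ ≤ w) (hϱ₀ : 0 < ϱ₀) (hϱ₀r : ϱ₀ ≤ r) :
    (WindowScheduleModWin.geometric r w q σ₀ ϱ₀ ρinf hq0 hq1 hσ₀ hσ₀w hϱ₀ hϱ₀r).ρw 0 =
        ρinf + ((1 + 2 * q) * σ₀ + ϱ₀) / (1 - q) ∧
      (∀ k, ρinf ≤ (WindowScheduleModWin.geometric r w q σ₀ ϱ₀ ρinf hq0 hq1 hσ₀ hσ₀w hϱ₀ hϱ₀r).ρw k ∧
        (WindowScheduleModWin.geometric r w q σ₀ ϱ₀ ρinf hq0 hq1 hσ₀ hσ₀w hϱ₀ hϱ₀r).ρw k ≤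
          ρinf + ((1 + 2 * q) * σ₀ + ϱ₀) / (1 - q)) ∧
      0 ≤ 2 * σ₀ / (ϱ₀ * q) :=
  ⟨WindowScheduleModWin.geometric_birthWindow hq0 hq1 hσ₀ hσ₀w hϱ₀ hϱ₀r,
    fun k => WindowScheduleModWin.geometric_window_bounds hq0 hq1 hσ₀ hσ₀w hϱ₀ hϱ₀r k, by positivity⟩

end Witness

end Summit.QuantumFields.BalabanUV.T4Continuum.NE1p.DressedTransportAssembledUniformSliceWin

end
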